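import Literature.AnabelianGeometry.SemiGraphs.WitnessIwahoriApprox
import Literature.AnabelianGeometry.AbsoluteAnabelian.CharacteristicOpenSubgroups
import Literature.AlgebraicGeometry.Frobenioids.Categories
import Mathlib.NumberTheory.Padics.RingHoms
import HarnessLib

/-!
# A slim, NOT topologically finitely generated profinite group with two mutually estranged malnormal
# procyclic subgroups: `P_ω = ℤ_p^ℕ ⋊ (1 + pℤ_p)`

Witness material for the abc-iut cell (layer L3, route T · T7d∞-NEG37, seat abc-iut-L3-t5): the vertex
group of a semi-graph of anabelioids satisfying ALL the hypotheses of [SemiAnbd] Thm. 3.7 — Mochizuki,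
*Semi-graphs of anabelioids*, Publ. RIMS **42** (2006), Def. 2.4 (ii) p. 25 (verticially slim), Def. 2.4
(iv) p. 26 (aloof / estranged) — which is NOT coherent (Def. 2.3 (iii) p. 25: coherent = quasi-coherent
with topologically finitely generated constituents).  Pure group theory over Mathlib's `ℤ_[p]` and the
cell's witness group `Iw p = ℤ_p ⋊ (1 + pℤ_p)` (w5's `WitnessIwahoriGroup`, ported coordinatewise and cited).
FRONTIER label (L3-lead β30): erratum-grade TIGHTNESS material for the cell's own heredity theorems
(route T); it retypes and changes NO statement of record; outside the [IUTchIII] Cor. 3.12 cone.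
* `IwSeq p` — `P_ω = ℤ_p^ℕ ⋊ U`, `U = 1 + pℤ_p` acting DIAGONALLY, realised WITHOUT new instances as the
  closed subgroup `seqSubgroup p` of `ℕ → Iw p` (sequences with constant unit coordinate); coordinates
  `x.a : ℕ → ℤ_p`, `x.s : ℤ_p`, law `(a, s)(b, t) = (a + (1 + p s) b, s ∗ t)`; compact (`compactSpace`).
* `IwSeq.bHomSeq c : IwU p →ₜ* IwSeq p`, `s ↦ ((c_i s)_i, s)` — the complements `T_c`; coordinatewise the
  `T_{c_i}` of `Iw p`, whence ESTRANGEMENT (`range_bHomSeq_inf_conj_eq_bot_of_ne`, `{c_0, c'_0} = {0, 1}`,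
  every conjugator) and MALNORMALITY (`range_bHomSeq_inf_conj_eq_bot_of_not_mem`) at one coordinate.
* `IwSeq.exists_finset_level_of_mem_nhds` (a neighbourhood of `1` contains a LEVEL BOX: finitely many
  coordinates at some level), the basis elements `single m`, and `IwSeq.isSlimGroup`.
* `IwSeq.χ m : IwSeq p →* ℤ/p`, `(a, s) ↦ a_m mod p` — continuous CHARACTERS (`1 + p s ≡ 1 mod p`),
  trivial on every `T_c` with `c_m = 0`, pairwise distinct; hence **`IwSeq.not_topologicallyFG`** by the
  (T4) count `card_setOf_monoidHom_isOpen_ker_le` of [IUTchI] Rmk. 2.5.3 (i).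
[cite: MochizukiSemiAnbd2006, Def 2.4 p.25-26]
-/

noncomputable section

open Topology

namespace Literature.AnabelianGeometry.SemiGraphs

open IwahoriWitness
open Literature.AlgebraicGeometry.Frobenioids (IsSlimGroup)

variable (p : ℕ) [Fact p.Prime]

/-! ## 1. The group `P_ω` as a closed subgroup of `∏_ℕ P` -/

/-- `P_ω ⊆ ∏_ℕ (ℤ_p ⋊ U)`: the sequences with CONSTANT unit coordinate — i.e. `ℤ_p^ℕ ⋊ U` with the
diagonal action. [cite: MochizukiSemiAnbd2006, §2 p.23] -/
def seqSubgroup : Subgroup (ℕ → Iw p) where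
  carrier := {x | ∀ i, (x i).s = (x 0).s}
  mul_mem' {x y} hx hy i := by simp only [Pi.mul_apply, Iw.mul_s, hx i, hy i]
  one_mem' _ := rfl
  inv_mem' {x} hx i := by simp only [Pi.inv_apply, Iw.inv_s, hx i]

/-- The group `P_ω = ℤ_p^ℕ ⋊ (1 + pℤ_p)` (the subgroup `seqSubgroup p` as a type: group, topological
group, totally disconnected — all inherited from `ℕ → Iw p`). [cite: MochizukiSemiAnbd2006, §2 p.23] -/
abbrev IwSeq : Type := ↥(seqSubgroup p)

namespace IwSeq

variable {p}

/-- The translation coordinates `a : ℕ → ℤ_p`. [cite: MochizukiSemiAnbd2006, §2 p.23] -/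
def a (x : IwSeq p) (i : ℕ) : ℤ_[p] := (x.1 i).a

/-- The unit coordinate `s` (`u = 1 + p s`). [cite: MochizukiSemiAnbd2006, §2 p.23] -/
def s (x : IwSeq p) : ℤ_[p] := (x.1 0).s

/-- All unit coordinates of an element of `P_ω` agree. [cite: MochizukiSemiAnbd2006, §2 p.23] -/
theorem apply_s (x : IwSeq p) (i : ℕ) : (x.1 i).s = x.s := x.2 i

/-- The element of `P_ω` with coordinates `(a, s)`. [cite: MochizukiSemiAnbd2006, §2 p.23] -/
def mk (a : ℕ → ℤ_[p]) (s : ℤ_[p]) : IwSeq p := ⟨fun i => ⟨a i, s⟩, fun _ => rfl⟩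

/-- Coordinates of `mk`. [cite: MochizukiSemiAnbd2006, §2 p.23] -/
@[simp] theorem mk_apply (a : ℕ → ℤ_[p]) (s : ℤ_[p]) (i : ℕ) : (mk a s).1 i = ⟨a i, s⟩ := rfl
/-- Coordinates of `mk`. [cite: MochizukiSemiAnbd2006, §2 p.23] -/
@[simp] theorem mk_a (a : ℕ → ℤ_[p]) (s : ℤ_[p]) (i : ℕ) : (mk a s).a i = a i := rfl
/-- Coordinates of `mk`. [cite: MochizukiSemiAnbd2006, §2 p.23] -/
@[simp] theorem mk_s (a : ℕ → ℤ_[p]) (s : ℤ_[p]) : (mk a s).s = s := rfl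

/-- Extensionality in the coordinates `(a, s)`. [cite: MochizukiSemiAnbd2006, §2 p.23] -/
theorem ext' {x y : IwSeq p} (ha : ∀ i, x.a i = y.a i) (hs : x.s = y.s) : x = y :=
  Subtype.ext (funext fun i => Iw.ext (ha i) (by rw [apply_s, apply_s, hs]))

/-- Coordinates of a product. [cite: MochizukiSemiAnbd2006, §2 p.23] -/
@[simp] theorem mul_a (x y : IwSeq p) (i : ℕ) : (x * y).a i = x.a i + w p x.s * y.a i := by
  show (x.1 i * y.1 i).a = _; rw [Iw.mul_a, apply_s]; rfl
/-- Coordinates of a product. [cite: MochizukiSemiAnbd2006, §2 p.23] -/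
@[simp] theorem mul_s (x y : IwSeq p) : (x * y).s = x.s + y.s + (p : ℤ_[p]) * x.s * y.s := rfl
/-- Coordinates of the identity. [cite: MochizukiSemiAnbd2006, §2 p.23] -/
@[simp] theorem one_a (i : ℕ) : (1 : IwSeq p).a i = 0 := rfl
/-- Coordinates of the identity. [cite: MochizukiSemiAnbd2006, §2 p.23] -/
@[simp] theorem one_s : (1 : IwSeq p).s = 0 := rfl
/-- Coordinates of an inverse. [cite: MochizukiSemiAnbd2006, §2 p.23] -/
@[simp] theorem inv_a (x : IwSeq p) (i : ℕ) : x⁻¹.a i = -(winv p x.s * x.a i) := by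
  show ((x.1 i)⁻¹).a = _; rw [Iw.inv_a, apply_s]; rfl
/-- Coordinates of an inverse. [cite: MochizukiSemiAnbd2006, §2 p.23] -/
@[simp] theorem inv_s (x : IwSeq p) : x⁻¹.s = -x.s * winv p x.s := rfl

/-! ## 2. Topology: closed in the product, compact; coordinates are continuous -/

/-- `P_ω` is closed in `∏_ℕ P`. [cite: MochizukiSemiAnbd2006, §2 p.23] -/
theorem isClosed_seqSubgroup : IsClosed (seqSubgroup p : Set (ℕ → Iw p)) := by
  have : (seqSubgroup p : Set (ℕ → Iw p)) = ⋂ i, {x | (x i).s = (x 0).s} := by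
    ext x; simp only [Set.mem_iInter, Set.mem_setOf_eq]; rfl
  rw [this]
  exact isClosed_iInter fun i => isClosed_eq (Iw.continuous_s.comp (continuous_apply i))
    (Iw.continuous_s.comp (continuous_apply 0))

/-- `P_ω` is compact (a closed subgroup of a profinite group). [cite: MochizukiSemiAnbd2006, §2 p.23] -/
theorem compactSpace : CompactSpace (IwSeq p) :=
  isCompact_iff_compactSpace.mp (isClosed_seqSubgroup (p := p)).isCompact

/-- `x ↦ x.a i` is continuous. [cite: MochizukiSemiAnbd2006, §2 p.23] -/
theorem continuous_a (i : ℕ) : Continuous fun x : IwSeq p => x.a i :=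
  Iw.continuous_a.comp ((continuous_apply i).comp continuous_subtype_val)

/-- `x ↦ x.s` is continuous. [cite: MochizukiSemiAnbd2006, §2 p.23] -/
theorem continuous_s : Continuous fun x : IwSeq p => x.s :=
  Iw.continuous_s.comp ((continuous_apply 0).comp continuous_subtype_val)

/-- A map into `P_ω` with continuous coordinates is continuous. [cite: MochizukiSemiAnbd2006, §2 p.23] -/
theorem continuous_mk {X : Type*} [TopologicalSpace X] {A : X → ℕ → ℤ_[p]} {S : X → ℤ_[p]}
    (hA : ∀ i, Continuous fun x => A x i) (hS : Continuous S) : Continuous fun x => mk (A x) (S x) :=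
  Continuous.subtype_mk (continuous_pi fun i => (Iw.continuous_mk_iff (p := p)).2 ⟨hA i, hS⟩) _

/-! ## 3. The complements `T_c`, `c : ℕ → ℤ_p` -/

/-- `b_c : U → P_ω`, `s ↦ ((c_i s)_i, s)` — coordinatewise the `b_{c_i}` of `P`; `c = 0` is the
diagonal torus, `c = δ_0` a complement twisted at the coordinate `0` only.
[cite: MochizukiSemiAnbd2006, Def 2.1 p.22] -/
def bHomSeq (c : ℕ → ℤ_[p]) : IwU p →ₜ* IwSeq p where
  toFun u := mk (fun i => c i * u.s) u.s
  map_one' := ext' (fun i => by simp) (by simp)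
  map_mul' u v := ext' (fun i => by simp only [mk_a, IwU.mul_s, mul_a, mk_s, w]; ring) (by simp)
  continuous_toFun := continuous_mk (fun _ => continuous_const.mul IwU.continuous_s) IwU.continuous_s

/-- Coordinates of `b_c`. [cite: MochizukiSemiAnbd2006, §2 p.23] -/
@[simp] theorem bHomSeq_a (c : ℕ → ℤ_[p]) (u : IwU p) (i : ℕ) : (bHomSeq c u).a i = c i * u.s := rfl
/-- Coordinates of `b_c`. [cite: MochizukiSemiAnbd2006, §2 p.23] -/
@[simp] theorem bHomSeq_s (c : ℕ → ℤ_[p]) (u : IwU p) : (bHomSeq c u).s = u.s := rfl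

/-- `b_c` is injective (injective type). [cite: MochizukiSemiAnbd2006, Def 2.1 p.22] -/
theorem bHomSeq_injective (c : ℕ → ℤ_[p]) : Function.Injective (bHomSeq c) := fun u v h => by
  ext; simpa using congrArg IwSeq.s h

/-- `T_c` is the graph `{((c_i s)_i, s)}`. [cite: MochizukiSemiAnbd2006, Def 2.1 p.22] -/
theorem mem_range_bHomSeq_iff (c : ℕ → ℤ_[p]) (x : IwSeq p) :
    x ∈ (bHomSeq c).toMonoidHom.range ↔ ∀ i, x.a i = c i * x.s := by
  constructor
  · rintro ⟨u, rfl⟩ i; rfl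
  · intro h
    exact ⟨⟨x.s⟩, ext' (fun i => by rw [h i]; rfl) rfl⟩

/-- An element of `T_c` has its `i`-th coordinate in `T_{c_i} ⊆ P`. [cite: MochizukiSemiAnbd2006, §2 p.23] -/
theorem apply_mem_range_bHom {c : ℕ → ℤ_[p]} {x : IwSeq p} (hx : x ∈ (bHomSeq c).toMonoidHom.range)
    (i : ℕ) : x.1 i ∈ (Iw.bHom (c i)).toMonoidHom.range := by
  rw [Iw.mem_range_bHom_iff, apply_s]
  exact (mem_range_bHomSeq_iff c x).1 hx i

/-- An element of `T_c` with unit coordinate `0` is trivial. [cite: MochizukiSemiAnbd2006, §2 p.23] -/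
theorem eq_one_of_mem_range_bHomSeq {c : ℕ → ℤ_[p]} {x : IwSeq p}
    (hx : x ∈ (bHomSeq c).toMonoidHom.range) (hs : x.s = 0) : x = 1 :=
  ext' (fun i => by rw [(mem_range_bHomSeq_iff c x).1 hx i, hs, mul_zero]; rfl) hs

/-- A conjugate `x y x⁻¹` of an element `y ∈ T_{c'}` has its `i`-th coordinate in the conjugate of
`T_{c'_i}` by `x_i`. [cite: MochizukiSemiAnbd2006, Def 2.4(iv) p.26] -/
theorem conj_apply_mem_map {c' : ℕ → ℤ_[p]} (x : IwSeq p) {y : IwSeq p}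
    (hy : y ∈ (bHomSeq c').toMonoidHom.range) (i : ℕ) :
    ((MulAut.conj x).toMonoidHom y).1 i ∈
      ((Iw.bHom (c' i)).toMonoidHom.range.map (MulAut.conj (x.1 i)).toMonoidHom) :=
  ⟨y.1 i, apply_mem_range_bHom hy i, rfl⟩

/-- **Estrangement of two complements differing at the coordinate `0` by `{0, 1}`**: for EVERY
`x ∈ P_ω`, `T_c ∩ x T_{c'} x⁻¹ = 1`. [cite: MochizukiSemiAnbd2006, Def 2.4(iv) p.26] -/
theorem range_bHomSeq_inf_conj_eq_bot_of_ne {c c' : ℕ → ℤ_[p]}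
    (h : (c 0 = 0 ∧ c' 0 = 1) ∨ (c 0 = 1 ∧ c' 0 = 0)) (x : IwSeq p) :
    (bHomSeq c).toMonoidHom.range ⊓ ((bHomSeq c').toMonoidHom.range.map (MulAut.conj x).toMonoidHom)
      = ⊥ := by
  rw [eq_bot_iff]
  rintro z ⟨hz, ⟨y, hy, rfl⟩⟩
  rw [Subgroup.mem_bot]
  have h0 : ((MulAut.conj x).toMonoidHom y).1 0 ∈ (Iw.bHom (c 0)).toMonoidHom.range ⊓
      ((Iw.bHom (c' 0)).toMonoidHom.range.map (MulAut.conj (x.1 0)).toMonoidHom) :=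
    ⟨apply_mem_range_bHom hz 0, conj_apply_mem_map x hy 0⟩
  rw [Iw.range_bHom_inf_conj_eq_bot_of_ne h, Subgroup.mem_bot] at h0
  exact eq_one_of_mem_range_bHomSeq hz (by change (((MulAut.conj x).toMonoidHom y).1 0).s = 0; rw [h0]; rfl)

/-- **Malnormality**: for `x ∉ T_c`, `T_c ∩ x T_c x⁻¹ = 1`. [cite: MochizukiSemiAnbd2006, Def 2.4(iv) p.26] -/
theorem range_bHomSeq_inf_conj_eq_bot_of_not_mem (c : ℕ → ℤ_[p]) {x : IwSeq p}
    (hx : x ∉ (bHomSeq c).toMonoidHom.range) :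
    (bHomSeq c).toMonoidHom.range ⊓ ((bHomSeq c).toMonoidHom.range.map (MulAut.conj x).toMonoidHom)
      = ⊥ := by
  rw [mem_range_bHomSeq_iff, not_forall] at hx
  obtain ⟨i, hi⟩ := hx
  have hxi : x.1 i ∉ (Iw.bHom (c i)).toMonoidHom.range := by
    rw [Iw.mem_range_bHom_iff, apply_s]; exact hi
  rw [eq_bot_iff]
  rintro z ⟨hz, ⟨y, hy, rfl⟩⟩
  rw [Subgroup.mem_bot]
  have h0 : ((MulAut.conj x).toMonoidHom y).1 i ∈ (Iw.bHom (c i)).toMonoidHom.range ⊓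
      ((Iw.bHom (c i)).toMonoidHom.range.map (MulAut.conj (x.1 i)).toMonoidHom) :=
    ⟨apply_mem_range_bHom hz i, conj_apply_mem_map x hy i⟩
  rw [Iw.range_bHom_inf_conj_eq_bot_of_not_mem (c i) hxi, Subgroup.mem_bot] at h0
  refine eq_one_of_mem_range_bHomSeq hz ?_
  rw [← apply_s _ i, h0]; rfl

/-- `T_c ≅ U` is infinite. [cite: MochizukiSemiAnbd2006, Def 2.4(iv) p.26] -/
theorem infinite_range_bHomSeq (c : ℕ → ℤ_[p]) : Infinite (bHomSeq (p := p) c).toMonoidHom.range :=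
  Infinite.of_injective (fun u : IwU p => ⟨bHomSeq c u, u, rfl⟩) fun _ _ h =>
    bHomSeq_injective c (congrArg Subtype.val h)

/-- A subgroup meeting `T_c` trivially has relative index `0` (infinite index) in it.
[cite: MochizukiSemiAnbd2006, Def 2.4(iv) p.26] -/
theorem relIndex_eq_zero_of_inf_eq_bot (c : ℕ → ℤ_[p]) {H : Subgroup (IwSeq p)}
    (h : (bHomSeq c).toMonoidHom.range ⊓ H = ⊥) : H.relIndex (bHomSeq c).toMonoidHom.range = 0 := by
  haveI := infinite_range_bHomSeq (p := p) c
  rw [Subgroup.relIndex, show H.subgroupOf (bHomSeq c).toMonoidHom.range = ⊥ from ?_, Subgroup.index_bot]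
  · exact Nat.card_eq_zero_of_infinite
  · rw [eq_bot_iff]
    intro z hz
    have : (z : IwSeq p) ∈ (bHomSeq c).toMonoidHom.range ⊓ H := ⟨z.2, hz⟩
    rw [h, Subgroup.mem_bot] at this
    rw [Subgroup.mem_bot]; exact Subtype.ext this

/-! ## 4. Level boxes in `P_ω`; slimness -/

/-- The basis element `δ_m = (e_m, 0)`: translation coordinate `1` at `m`, `0` elsewhere, unit
coordinate `0`. [cite: MochizukiSemiAnbd2006, §2 p.23] -/
def single (m : ℕ) : IwSeq p :=
  ⟨Pi.mulSingle m (⟨1, 0⟩ : Iw p), fun i => by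
    simp only [Pi.mulSingle_apply]
    split_ifs <;> rfl⟩

/-- The coordinates of `δ_m` off `m` are trivial. [cite: MochizukiSemiAnbd2006, §2 p.23] -/
theorem single_apply_of_ne {m i : ℕ} (h : i ≠ m) : (single (p := p) m).1 i = 1 :=
  Pi.mulSingle_eq_of_ne h _

/-- `δ_m` has translation coordinate `1` at `m`. [cite: MochizukiSemiAnbd2006, §2 p.23] -/
@[simp] theorem single_a_self (m : ℕ) : (single (p := p) m).a m = 1 := by
  show (Pi.mulSingle (M := fun _ => Iw p) m (⟨1, 0⟩ : Iw p) m).a = 1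
  rw [Pi.mulSingle_eq_same]

/-- `δ_m` has translation coordinate `0` off `m`. [cite: MochizukiSemiAnbd2006, §2 p.23] -/
theorem single_a_of_ne {m i : ℕ} (h : i ≠ m) : (single (p := p) m).a i = 0 := by
  show ((single (p := p) m).1 i).a = 0
  rw [single_apply_of_ne h]; rfl

/-- `δ_m` has unit coordinate `0`. [cite: MochizukiSemiAnbd2006, §2 p.23] -/
@[simp] theorem single_s (m : ℕ) : (single (p := p) m).s = 0 := by
  show (Pi.mulSingle (M := fun _ => Iw p) m (⟨1, 0⟩ : Iw p) 0).s = 0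
  rw [Pi.mulSingle_apply]
  split_ifs <;> rfl

/-- The reduction of `P` kills `(0, p^N)` at level `N`. [cite: MochizukiSemiAnbd2006, Def 2.3(i) p.24] -/
theorem toMod_zero_pow (N : ℕ) : Iw.toMod N (⟨0, (p : ℤ_[p]) ^ N⟩ : Iw p) = 1 := by
  rw [Iw.toMod_eq_one_iff]
  refine ⟨by simp, ?_⟩
  change ‖(p : ℤ_[p]) ^ N‖ ≤ _
  rw [PadicInt.norm_p_pow]

/-- **Level boxes.** A neighbourhood of `1` in `P_ω` contains, for some finite set `I` of coordinates and
some level `N`, every `x` whose coordinates in `I` lie in the level-`N` kernel of `P → P_N` (product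
topology + the level boxes of `P`). [cite: MochizukiSemiAnbd2006, Def 2.3(iii) p.25] -/
theorem exists_finset_level_of_mem_nhds {V : Set (IwSeq p)} (hV : V ∈ 𝓝 (1 : IwSeq p)) :
    ∃ (I : Finset ℕ) (N : ℕ), ∀ x : IwSeq p, (∀ i ∈ I, Iw.toMod N (x.1 i) = 1) → x ∈ V := by
  obtain ⟨O, hO, hOV⟩ := (mem_nhds_subtype _ _ _).1 hV
  have hO' : O ∈ 𝓝 (1 : ℕ → Iw p) := hO
  rw [nhds_pi, Filter.mem_pi'] at hO'
  obtain ⟨I, t, ht, hsub⟩ := hO'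
  have hn : ∀ i, ∃ n : ℕ, ∀ g : Iw p, Iw.toMod n g = 1 → g ∈ t i := fun i =>
    Iw.exists_level_subset_of_mem_nhds (ht i)
  choose n hn using hn
  refine ⟨I, I.sup n, fun x hx => hOV ?_⟩
  show x.1 ∈ O
  refine hsub fun i hi => hn i _ (Iw.toMod_eq_one_mono ?_ _ (hx i (Finset.mem_coe.1 hi)))
  exact Finset.le_sup (f := n) (Finset.mem_coe.1 hi)

/-- Off the finite set of a level box, the `δ_m` lie in the neighbourhood. [cite: MochizukiSemiAnbd2006, Def 2.3(iii) p.25] -/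
theorem single_mem_of_box {V : Set (IwSeq p)} {I : Finset ℕ} {N : ℕ}
    (hbox : ∀ x : IwSeq p, (∀ i ∈ I, Iw.toMod N (x.1 i) = 1) → x ∈ V) {m : ℕ} (hm : m ∉ I) :
    single m ∈ V :=
  hbox _ fun i hi => by
    rw [single_apply_of_ne (m := m) (i := i) (by rintro rfl; exact hm hi), map_one]

/-- The element `(0, p^N)` lies in a level-`N` box. [cite: MochizukiSemiAnbd2006, Def 2.3(iii) p.25] -/
theorem mk_zero_pow_mem_of_box {V : Set (IwSeq p)} {I : Finset ℕ} {N : ℕ}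
    (hbox : ∀ x : IwSeq p, (∀ i ∈ I, Iw.toMod N (x.1 i) = 1) → x ∈ V) :
    mk (fun _ => 0) ((p : ℤ_[p]) ^ N) ∈ V :=
  hbox _ fun _ _ => toMod_zero_pow N

/-- A neighbourhood of `1` in `P_ω` contains all but finitely many `δ_m`. [cite: MochizukiSemiAnbd2006, Def 2.3(iii) p.25] -/
theorem exists_single_mem_of_mem_nhds {V : Set (IwSeq p)} (hV : V ∈ 𝓝 (1 : IwSeq p)) :
    ∃ I : Finset ℕ, ∀ m ∉ I, single m ∈ V := by
  obtain ⟨I, N, hbox⟩ := exists_finset_level_of_mem_nhds hV; exact ⟨I, fun m hm => single_mem_of_box hbox hm⟩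

/-- **`P_ω` is slim**: the centraliser of an open subgroup `H` is trivial — `H` contains some `δ_m`
(commuting with it forces `s = 0`) and some `(0, p^N)` (commuting with it forces `a = 0`).
[cite: MochizukiSemiAnbd2006, Def 2.4(ii) p.25] -/
theorem centralizer_eq_bot_of_isOpen (H : Subgroup (IwSeq p)) (hH : IsOpen (H : Set (IwSeq p))) :
    Subgroup.centralizer (H : Set (IwSeq p)) = ⊥ := by
  obtain ⟨I, N, hbox⟩ := exists_finset_level_of_mem_nhds (hH.mem_nhds H.one_mem)
  obtain ⟨m, hm⟩ := Infinite.exists_notMem_finset I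
  have h1 : single m ∈ H := single_mem_of_box hbox hm
  have h2 : mk (fun _ => 0) ((p : ℤ_[p]) ^ N) ∈ H := mk_zero_pow_mem_of_box hbox
  rw [eq_bot_iff]
  intro z hz
  rw [Subgroup.mem_centralizer_iff] at hz; rw [Subgroup.mem_bot]
  have hpN : ((p : ℤ_[p]) ^ N) ≠ 0 := pow_ne_zero _ Iw.p_ne_zero
  -- commuting with `δ_m` forces `z.s = 0`
  have hs : z.s = 0 := by
    have ha := congrArg (fun x : IwSeq p => x.a m) (hz _ h1)
    simp only [mul_a, single_a_self, single_s, w, mul_zero, add_zero, one_mul, mul_one] at ha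
    -- ha : 1 + z.a m = z.a m + (1 + p * z.s)
    have : (p : ℤ_[p]) * z.s = 0 := by linear_combination -ha
    exact (mul_eq_zero.1 this).resolve_left Iw.p_ne_zero
  -- commuting with `(0, p^N)` forces `z.a = 0`
  have ha : ∀ i, z.a i = 0 := fun i => by
    have e := congrArg (fun x : IwSeq p => x.a i) (hz _ h2)
    simp only [mul_a, mk_a, mk_s, hs, w, mul_zero, add_zero, zero_add] at e
    -- e : (1 + p * p ^ N) * z.a i = z.a i
    have : (p : ℤ_[p]) * (p : ℤ_[p]) ^ N * z.a i = 0 := by linear_combination e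
    exact (mul_eq_zero.1 this).resolve_left (mul_ne_zero Iw.p_ne_zero hpN)
  exact ext' (fun i => by rw [ha i]; rfl) (by rw [hs]; rfl)

/-- **`P_ω` is slim.** [cite: MochizukiSemiAnbd2006, Def 2.4(ii) p.25] -/
theorem isSlimGroup : IsSlimGroup (IwSeq p) := ⟨centralizer_eq_bot_of_isOpen⟩

/-! ## 5. The characters `(a, s) ↦ a_m mod p`; `P_ω` is not topologically finitely generated -/

/-- `1 + p s ≡ 1 mod p`. [cite: MochizukiSemiAnbd2006, Def 2.3(iii) p.25] -/
theorem toZMod_w (s : ℤ_[p]) : PadicInt.toZMod (w p s) = 1 := by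
  unfold w
  rw [map_add, map_one, map_mul, map_natCast, ZMod.natCast_self, zero_mul, add_zero]

/-- The character `χ_m : P_ω → ℤ/p`, `(a, s) ↦ a_m mod p` (a homomorphism because the unit coordinate
acts trivially modulo `p`). [cite: MochizukiSemiAnbd2006, Def 2.3(iii) p.25] -/
def χ (m : ℕ) : IwSeq p →* Multiplicative (ZMod p) where
  toFun x := Multiplicative.ofAdd (PadicInt.toZMod (x.a m))
  map_one' := by simp
  map_mul' x y := by
    rw [← ofAdd_add, mul_a, map_add, map_mul, toZMod_w, one_mul]

/-- `χ_m` in closed form. [cite: MochizukiSemiAnbd2006, Def 2.3(iii) p.25] -/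
theorem χ_apply (m : ℕ) (x : IwSeq p) : χ m x = Multiplicative.ofAdd (PadicInt.toZMod (x.a m)) := rfl

/-- `χ_m` has open kernel (it is continuous): the kernel is the preimage of the open unit ball of `ℤ_p`
under the `m`-th translation coordinate. [cite: MochizukiSemiAnbd2006, Def 2.3(iii) p.25] -/
theorem isOpen_ker_χ (m : ℕ) : IsOpen ((χ (p := p) m).ker : Set (IwSeq p)) := by
  have hset : ((χ (p := p) m).ker : Set (IwSeq p)) = (fun x : IwSeq p => x.a m) ⁻¹' Metric.ball 0 1 := by
    ext x
    rw [SetLike.mem_coe, MonoidHom.mem_ker, χ_apply, Set.mem_preimage, Metric.mem_ball, dist_zero_right,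
      ← PadicInt.mem_nonunits, ← IsLocalRing.mem_maximalIdeal, ← PadicInt.ker_toZMod, RingHom.mem_ker]
    exact ⟨fun h => Multiplicative.ofAdd.injective h, fun h => by rw [h]; rfl⟩
  rw [hset]
  exact Metric.isOpen_ball.preimage (continuous_a m)

/-- `χ_m(δ_m) = 1 mod p ≠ 0`. [cite: MochizukiSemiAnbd2006, Def 2.3(iii) p.25] -/
theorem χ_single_self (m : ℕ) : χ m (single (p := p) m) ≠ 1 := by
  rw [χ_apply, single_a_self, map_one]
  exact fun h => one_ne_zero (Multiplicative.ofAdd.injective h)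

/-- `χ_m(δ_{m'}) = 1` for `m ≠ m'`. [cite: MochizukiSemiAnbd2006, Def 2.3(iii) p.25] -/
theorem χ_single_of_ne {m m' : ℕ} (h : m ≠ m') : χ m (single (p := p) m') = 1 := by
  rw [χ_apply, single_a_of_ne h, map_zero]; rfl

/-- `χ_m` is trivial on every complement `T_c` with `c_m = 0`. [cite: MochizukiSemiAnbd2006, Def 2.3(iii) p.25] -/
theorem χ_eq_one_of_mem_range_bHomSeq {m : ℕ} {c : ℕ → ℤ_[p]} (hc : c m = 0) {x : IwSeq p}
    (hx : x ∈ (bHomSeq c).toMonoidHom.range) : χ m x = 1 := by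
  rw [χ_apply, (mem_range_bHomSeq_iff c x).1 hx m, hc, zero_mul, map_zero]; rfl

/-- `χ_m` is invariant under conjugation (its target is commutative). [cite: MochizukiSemiAnbd2006, Def 2.3(iii) p.25] -/
theorem χ_conj (m : ℕ) (x y : IwSeq p) : χ m (x * y * x⁻¹) = χ m y := by
  rw [map_mul, map_mul, map_inv, mul_right_comm, mul_inv_cancel, one_mul]

/-- **`P_ω` is NOT topologically finitely generated**: a group topologically generated by a finset `S`
has at most `p ^ |S|` continuous characters to `ℤ/p` (the (T4) count
`card_setOf_monoidHom_isOpen_ker_le` of [IUTchI] Rmk. 2.5.3 (i)), whereas the `χ_m` are pairwise distinct.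
[cite: MochizukiSemiAnbd2006, Def 2.3(iii) p.25] -/
theorem not_topologicallyFG :
    ¬ ∃ S : Finset (IwSeq p), (Subgroup.closure (S : Set (IwSeq p))).topologicalClosure = ⊤ := by
  rintro ⟨S, hS⟩
  have hfin := (Literature.AnabelianGeometry.AbsoluteAnabelian.IsTopologicallyFinitelyGenerated.card_setOf_monoidHom_isOpen_ker_le
    (M := Multiplicative (ZMod p)) S hS).1
  let ev : ℕ → {ρ : IwSeq p →* Multiplicative (ZMod p) | IsOpen (ρ.ker : Set (IwSeq p))} :=
    fun m => ⟨χ m, isOpen_ker_χ m⟩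
  have hinj : Function.Injective ev := by
    intro m m' h; by_contra hne
    have h1 : (ev m).1 (single m) = (ev m').1 (single m) := by rw [h]
    change χ m (single m) = χ m' (single m) at h1
    rw [χ_single_of_ne (Ne.symm hne)] at h1
    exact χ_single_self m h1
  haveI := hfin; haveI := Infinite.of_injective ev hinj
  exact not_finite {ρ : IwSeq p →* Multiplicative (ZMod p) | IsOpen (ρ.ker : Set (IwSeq p))}

end IwSeq

end Literature.AnabelianGeometry.SemiGraphs

end
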